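import Summits.BirchSwinnertonDyer.BirchSwinnertonDyer.Theorems.AdditiveBranchIMCGordTwoRankZeroCompanionRecord84966ea1
import Summits.BirchSwinnertonDyer.BirchSwinnertonDyer.Theorems.AdditiveBranchIMCGordTwoRankZeroCompanionDoorsX4
import Summits.BirchSwinnertonDyer.Rank1Residual.AdditivePotMult.RankZeroShaEightyOneCertificateIntModel
import Summits.BirchSwinnertonDyer.Rank1Residual.Additive.JValuationOfIntModel
import Summits.BirchSwinnertonDyer.Rank1Residual.Supersingular.LocalOddTorsionAdicCompletionAt
import Summits.BirchSwinnertonDyer.Rank1Residual.Supersingular.RationalLadder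
import Summits.BirchSwinnertonDyer.Rank1Residual.Supersingular.IntModelMinimalityKrausTwoMore
import Summits.BirchSwinnertonDyer.Rank1Residual.Supersingular.X7VisibilityWitnessRecords02
import Summits.BirchSwinnertonDyer.Rank1Residual.Supersingular.X7VisibilityShapeFiveKinds
import Summits.BirchSwinnertonDyer.Rank1Residual.Supersingular.X6VisibilityTamDefectShape
import Summits.BirchSwinnertonDyer.Rank1Residual.Supersingular.NonsplitByEuler
import Summits.BirchSwinnertonDyer.Rank1Residual.Supersingular.SurjSerreCertificateShape
import Summits.BirchSwinnertonDyer.Rank1Residual.SecondDescent.X10aPrimeTargetsKernelCertificates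
import Summits.BirchSwinnertonDyer.Rank1Residual.Additive.X4ThreeResCertKernel
import Summits.BirchSwinnertonDyer.Rank1Residual.GaloisImage.FormalGroupLocalDivisibilityRat
import Summits.BirchSwinnertonDyer.Rank1Residual.GaloisImage.PadicTwistClassDecider
import Literature.NumberTheory.GaloisRepresentations.LocalH2VanishingTrivialModule
import Literature.NumberTheory.GaloisRepresentations.TateLevelOneLocalGenerators
import Summits.BirchSwinnertonDyer.Rank1Residual.GaloisImage.LocalThreeTorsionAdicCompletionAt
import HarnessLib

/-!
# Numeric certificates (models, image, reduction types, local kinds) for the companion record `84966ea1 @ 7` ← partner `F` (Cremona `84966dx2`, rank 2; additive at `7`)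

Cell `bsd-addord`, seat `bsd-addord-k1-c2` (D-0074 row B1), gen 10 (gen-9 generator). HONEST FRAMING: nothing here proves the Birch–Swinnerton-Dyer
conjecture or the crux `GordTwoRankZeroOffCaseOne` (item 19357); THEOREMS ONLY (no definition, no named fact, no `sorry`); per pair; nothing booked.
Every statement is decided by the kernel (`decide +kernel` / `norm_num`); consumed by `…CompanionX4Record84966ea1.lean`. References as there.
-/

set_option autoImplicit false

noncomputable section

open scoped Classical

open WeierstrassCurve Literature.NumberTheory.EllipticCurves
  Literature.NumberTheory.EllipticCurves.Rank1Residual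
  Literature.NumberTheory.EllipticCurves.Rank1Residual.Typed
  Literature.NumberTheory.EllipticCurves.Rank1Residual.X11RankOneCertificates
  Literature.NumberTheory.EllipticCurves.Wuthrich2014
  Literature.NumberTheory.EllipticCurves.Fisher2016
  Literature.NumberTheory.EllipticCurves.MazurRubin2015
  Literature.NumberTheory.EllipticCurves.ModularForms
  Literature.NumberTheory.GaloisRepresentations
  Summit.BirchSwinnertonDyer.BirchSwinnertonDyer.Rank1Residual.IntModel
  Summit.BirchSwinnertonDyer.Rank1Residual.X11b
  Summit.BirchSwinnertonDyer.Rank1Residual.GaloisImage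
  Summit.BirchSwinnertonDyer.Rank1Residual.Supersingular
  Summit.BirchSwinnertonDyer.Rank1Residual.SecondDescent
open NumberField IsDedekindDomain Rat.HeightOneSpectrum Field
open Summit.BirchSwinnertonDyer.Rank1Residual.Supersingular.LocalOddTorsion

set_option linter.dupNamespace false

namespace Summit.BirchSwinnertonDyer.BirchSwinnertonDyer.Theorems.AdditiveBranchIMCGordTwoRankZeroCompanionX4

open Summit.BirchSwinnertonDyer.Rank1Residual
open Summit.BirchSwinnertonDyer.Rank1Residual.Additive
open Summit.BirchSwinnertonDyer.BirchSwinnertonDyer.Theorems.AdditiveBranchIMCGordTwoRankZeroCompanion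

/-! ### The two models -/

/-- `[1, 0, 0, -6376077, 6196425129]` (the partner `F` = Cremona `84966dx2`, minimal model) is an elliptic curve: `Δ = −2³·3³·7⁶·17² ≠ 0`. [cite: SilvermanAEC2009, III.1] -/
theorem isElliptic_c84966dx2 : (⟨1, 0, 0, -6376077, 6196425129⟩ : WeierstrassCurve ℚ).IsElliptic :=
  isElliptic_of_discOf_ne_zero 1 0 0 (-6376077) 6196425129 (by decide +kernel)

/-- `c84966dx2` is globally minimal: complete factorisation `|Δ| = 2^3·3^3·7^6·17^2` kernel-checked and Kraus' criterion prime by prime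
(`isGloballyMinimal_of_krausCriterion₃_factored`). [cite: SilvermanAEC2009, VII.1 Remark 1.1] [cite: Kraus1989, Prop. 1 and Prop. 2] -/
theorem isGloballyMinimal_c84966dx2 : (⟨1, 0, 0, -6376077, 6196425129⟩ : WeierstrassCurve ℚ).IsGloballyMinimal :=
  isGloballyMinimal_of_krausCriterion₃_factored 1 0 0 (-6376077) 6196425129
    [(2, 3), (3, 3), (7, 6), (17, 2)] (by decide +kernel)
    (by intro qe hqe; simp only [List.mem_cons, List.not_mem_nil, or_false] at hqe
        rcases hqe with rfl | rfl | rfl | rfl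
        · norm_num
        · norm_num
        · norm_num
        · norm_num)
    (by set_option synthInstance.maxSize 2000 in decide +kernel)

end Summit.BirchSwinnertonDyer.BirchSwinnertonDyer.Theorems.AdditiveBranchIMCGordTwoRankZeroCompanionX4

end
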